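import Mathlib
import Summits.ValiantsHypothesis.ValiantsHypothesis.Theorems.RigidityForcesSymmetryRankRigidMinimalReprLaplaceFiveParallelPairs
import Summits.ValiantsHypothesis.ValiantsHypothesis.Theorems.RigidityForcesSymmetryRankRigidMinimalReprLaplaceFiveThreeSlicesTransport

/-!
# `LaplaceOptimalFive`, slice class `a = 3`: the parallel-pairs type C8 on the cuts `(0,2)³` and `(1,2)³`
# (crux `RankRigidMinimalRepr`, stmt-ValiantsHypothesis-18034; frontier rung `LaplaceOptimalFive`, stmt-24813)

The two relabelled instances of `three_slices_exc_C_010101` (`…LaplaceFiveParallelPairs.lean`: three slices on the slots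
`0, 1, 2` and three pair terms on one cut inside `{0,1,2}` never sum to the `5 × 5` permutation pattern), in the format of
the hypothesis `hexC` of `three_slices_three_pairs_all` (`…LaplaceFiveThreeSlicesAll.lean`) at the sorted configurations
`(0,2,0,2,0,2)` and `(1,2,1,2,1,2)`: obtained from the `(0,1)³` case by the slot relabelling `swap 1 2`, resp. the 3-cycle
`0 ↦ 2 ↦ 1 ↦ 0`, with the matching re-indexing of the slices (`three_slices_transport_slots` of
`…LaplaceFiveThreeSlicesTransport.lean`).  No new definitions.  HONEST FRAMING: an exact partial result toward the frontier
rung `LaplaceOptimalFive` (stmt-24813), which stays OPEN; nothing here bears on `VP ≠ VNP`.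
-/

set_option autoImplicit false

-- the mandated summit-side namespace repeats a component by design (single-problem summit)
set_option linter.dupNamespace false

namespace Summit.ValiantsHypothesis.ValiantsHypothesis.Theorems.RigidityForcesSymmetryRankRigidMinimalRepr

namespace LaplaceFiveSlices

open Finset

/-- **Type C8**, cuts `(0,2)³`: format of `hexC` at `(0,2,0,2,0,2)`; from the `(0,1)³` case by the slot relabelling
`swap 1 2` (with the matching slice re-indexing). -/
theorem three_slices_exc_C_020202 :
    ∀ (α : Fin 3 → Fin 5 → ℂ) (W : Fin 3 → (Fin 5 → Fin 5) → ℂ),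
      (∀ k, ∀ v v' : Fin 5 → Fin 5, (∀ j, j ≠ (![0, 1, 2] : Fin 3 → Fin 5) k → v j = v' j) → W k v = W k v') →
      ∀ (u w : Fin 3 → (Fin 5 → Fin 5) → ℂ),
      (∀ t, ∀ v v' : Fin 5 → Fin 5,
          v ((![0, 0, 0] : Fin 3 → Fin 5) t) = v' ((![0, 0, 0] : Fin 3 → Fin 5) t) →
          v ((![2, 2, 2] : Fin 3 → Fin 5) t) = v' ((![2, 2, 2] : Fin 3 → Fin 5) t) → u t v = u t v') →
      (∀ t, ∀ v v' : Fin 5 → Fin 5,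
          (∀ j, j ≠ (![0, 0, 0] : Fin 3 → Fin 5) t → j ≠ (![2, 2, 2] : Fin 3 → Fin 5) t → v j = v' j) →
          w t v = w t v') →
      ¬ ∀ v : Fin 5 → Fin 5, (if Function.Injective v then (1 : ℂ) else 0) =
          (∑ k, α k (v ((![0, 1, 2] : Fin 3 → Fin 5) k)) * W k v) + ∑ t, u t v * w t v := by
  intro α W hW u w hu hw
  have hI : ∀ k, (Equiv.swap (1 : Fin 5) 2) ((![0, 1, 2] : Fin 3 → Fin 5) ((Equiv.swap (1 : Fin 3) 2) k)) =
      (![0, 1, 2] : Fin 3 → Fin 5) k := by decide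
  have hP : ∀ t : Fin 3, (Equiv.swap (1 : Fin 5) 2) ((![0, 0, 0] : Fin 3 → Fin 5) t) =
      (![0, 0, 0] : Fin 3 → Fin 5) t := by decide
  have hQ : ∀ t : Fin 3, (Equiv.swap (1 : Fin 5) 2) ((![2, 2, 2] : Fin 3 → Fin 5) t) =
      (![1, 1, 1] : Fin 3 → Fin 5) t := by decide
  refine three_slices_transport_slots (Equiv.swap 1 2) (Equiv.swap 1 2) ![0, 1, 2] ![0, 1, 2] hI ![0, 0, 0] ![2, 2, 2]
    ?_ α W hW u w hu hw
  intro α' W' hW' u' w' hu' hw'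
  simp only [hP, hQ] at hu' hw'
  exact three_slices_exc_C_010101 α' W' hW' u' w' hu' hw'

/-- **Type C8**, cuts `(1,2)³`: format of `hexC` at `(1,2,1,2,1,2)`; from the `(0,1)³` case by the 3-cycle
`0 ↦ 2 ↦ 1 ↦ 0` of the slots (with the matching slice re-indexing). -/
theorem three_slices_exc_C_121212 :
    ∀ (α : Fin 3 → Fin 5 → ℂ) (W : Fin 3 → (Fin 5 → Fin 5) → ℂ),
      (∀ k, ∀ v v' : Fin 5 → Fin 5, (∀ j, j ≠ (![0, 1, 2] : Fin 3 → Fin 5) k → v j = v' j) → W k v = W k v') →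
      ∀ (u w : Fin 3 → (Fin 5 → Fin 5) → ℂ),
      (∀ t, ∀ v v' : Fin 5 → Fin 5,
          v ((![1, 1, 1] : Fin 3 → Fin 5) t) = v' ((![1, 1, 1] : Fin 3 → Fin 5) t) →
          v ((![2, 2, 2] : Fin 3 → Fin 5) t) = v' ((![2, 2, 2] : Fin 3 → Fin 5) t) → u t v = u t v') →
      (∀ t, ∀ v v' : Fin 5 → Fin 5,
          (∀ j, j ≠ (![1, 1, 1] : Fin 3 → Fin 5) t → j ≠ (![2, 2, 2] : Fin 3 → Fin 5) t → v j = v' j) →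
          w t v = w t v') →
      ¬ ∀ v : Fin 5 → Fin 5, (if Function.Injective v then (1 : ℂ) else 0) =
          (∑ k, α k (v ((![0, 1, 2] : Fin 3 → Fin 5) k)) * W k v) + ∑ t, u t v * w t v := by
  intro α W hW u w hu hw
  let σ : Equiv.Perm (Fin 5) := ⟨![2, 0, 1, 3, 4], ![1, 2, 0, 3, 4], by decide, by decide⟩
  let π : Equiv.Perm (Fin 3) := ⟨![1, 2, 0], ![2, 0, 1], by decide, by decide⟩
  have hI : ∀ k, σ ((![0, 1, 2] : Fin 3 → Fin 5) (π k)) = (![0, 1, 2] : Fin 3 → Fin 5) k := by decide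
  have hP : ∀ t : Fin 3, σ ((![1, 1, 1] : Fin 3 → Fin 5) t) = (![0, 0, 0] : Fin 3 → Fin 5) t := by decide
  have hQ : ∀ t : Fin 3, σ ((![2, 2, 2] : Fin 3 → Fin 5) t) = (![1, 1, 1] : Fin 3 → Fin 5) t := by decide
  refine three_slices_transport_slots σ π ![0, 1, 2] ![0, 1, 2] hI ![1, 1, 1] ![2, 2, 2] ?_ α W hW u w hu hw
  intro α' W' hW' u' w' hu' hw'
  simp only [hP, hQ] at hu' hw'
  exact three_slices_exc_C_010101 α' W' hW' u' w' hu' hw'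

end LaplaceFiveSlices

end Summit.ValiantsHypothesis.ValiantsHypothesis.Theorems.RigidityForcesSymmetryRankRigidMinimalRepr
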